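import Mathlib
import Summits.AtomisticToContinuum.HydrodynamicLimit.Theorems.InformationPercolationEngineKickFairRelEquilibriumMesoShortFlightRung0A
import Summits.AtomisticToContinuum.HydrodynamicLimit.Theorems.InformationPercolationEngineKickFairRelEquilibriumMesoShortFlightRung0B
import Literature.MathematicalPhysics.KineticTheory.CollisionFluxMeanBound
import HarnessLib

/-!
# `KickFairRelEquilibriumMeso`, line `Sketch` — stub U (`stub_shortFlightLG`) at RUNG 0, in mean form

Helper file (`--supports stmt-AtomisticToContinuum-15177`) of the line lead for the registered stub
`stub_shortFlightLG` of the skeleton (`Cruxes/KickFairRelEquilibriumMeso/Lines/Sketch.lean`): the normalised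
number of collisions preceded by a SHORT free flight,
`W_sf(A) = (ε/(N+1)) Σ_i #{n < cnt_i(τ) : t_{i,n} − flightStart(0, i, t_{i,n}) < t_N/A}`, has mean `≤ δ` for `A`
large, uniformly in `N` — here under the local Gibbs law with CONSTANT profiles (the homogeneous canonical Gibbs
law `G_N`, invariant under every hard-sphere flow, `measurePreserving_flow_localGibbsLaw_const`), i.e. the stub's
conclusion verbatim at constant profiles (`shortFlightLG_rung0`). It documents that the open content of U is
purely the non-equilibrium transfer (for continuous profiles `LG` is not invariant).

Proof (a FIRST-MOMENT / collision-flux computation, Cercignani–Illner–Pulvirenti 1994 App. 4.A,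
Gallagher–Saint-Raymond–Texier 2013 Prop. 4.1.1):
* pathwise on the good set `W ≤ (ε/(N+1)) · #short(Δ)`, `Δ = t_N/A`, with the short-flight count of
  `ShortFlightCharging` (`sum_shortFlag_le_collisionPairSum`, part B), and `#short ≤ K₁ + K₃ + 2 K_F`
  (`shortFlightCount_le_chargedSums`);
* the MEAN of each charged term under `G_N` (`localGibbsLaw_lintegral_shortFlightCount_le`): `K₁` (collisions
  before time `Δ`, mark `1`, horizon `Δ`) and `K₃` (velocity mark `‖w − v‖/R`, `R = (1/2 − ε)/Δ ≥ 1/(4Δ)`) by the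
  mean collision-flux engine `localGibbsLaw_lintegral_le_of_le_collisionMarkSum`, the forward-contact term `K_F`
  by its three-label mean form `localGibbsLaw_lintegral_le_of_le_fwdHitCollisionSum` (part A); the three means
  are added after cutting to the good set, `K₁` and `K₃` being measurable there (part B), whence
  `E_{G_N}[#short(Δ)] ≤ Δ (16 (N+1)²ε² m₁ + 64 τ (N+1)²ε² m₂ + 512 τ (N+1)³ε⁴ m₂)`;
* the rung-0 statics (`posGibbs_pairEvent_le`, `posGibbs_tripleEvent_le`, `exists_sweptTube`,
  `volume_setOf_exists_reprSym_add_latticeVec_mem_le`) at small reduced density, the Gaussian moments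
  `m₁, m₂ ≤ M₁ = 1 + 4(‖u‖² + 3θ)`, and the scaling `ε = σ t_N`, `(N+1) t_N³ = 1`:
  `E[W_sf(A)] ≤ M₁ (16 σ³ t_N + 64 τ σ³ t_N + 512 τ σ⁵)/A ≤ M₁ (16 + 576 τ)/A = δ` for `A = M₁ (16 + 576 τ)/δ`,
  all `N ≥ 1`, `σ ≤ 1/4`.
-/

noncomputable section

open MeasureTheory Set Filter Topology
open scoped ENNReal InnerProductSpace BigOperators Classical

namespace Summit.AtomisticToContinuum.HydrodynamicLimit.Theorems.KickFairRelEquilibriumMesoLine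

open Literature.Analysis.FluidPDE Literature.Analysis.FunctionSpaces Literature.MathematicalPhysics.KineticTheory
open Summit.AtomisticToContinuum.HydrodynamicLimit.Theorems.EvenStressEnskog

/-! ## The mean of the short-flight count under the homogeneous Gibbs law -/

/-- **Mean bound for the short-flight count (rung 0, abstract statics).** For `0 ≤ σ ≤ 1/4`, constant
profiles `a, θ > 0`, `u`, a flow `Φ` of `N + 1` spheres of diameter `ε = hsDiameter σ N` preserving the homogeneous
Gibbs law (`hstat`), the canonical pair and three-label bounds `hpair`, `htriple`, swept tubes `htube` and the lift
inequality `hlift`: for `τ, ℓ > 0` the mean over `G_N` of the number of ordered collisions `(s, i, j)`, `s ∈ [0, τ]`,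
of a good orbit with pair flight start `> s − ℓ` (cut to the good set) is at most
`ℓ (16 (N+1)²ε² m₁ + (64 τ (N+1)²ε² + 512 τ (N+1)³ε⁴) m₂)`, `m₁ = ∫ ‖q.2 − q.1‖`, `m₂ = ∫ ‖q.2 − q.1‖²` against
`N(u,θ) ⊗ N(u,θ)` (the mean form of `localGibbsLaw_shortFlightCount_ge_le`). [folklore] -/
theorem localGibbsLaw_lintegral_shortFlightCount_le {σ : ℝ} (hσ : 0 ≤ σ) (hσ4 : σ ≤ 1 / 4) {a θ : ℝ}
    (ha : 0 < a) (hθ : 0 < θ) (u : V3) {N : ℕ} (Φ : Flow σ N)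
    (hstat : ∀ t : ℝ, MeasurePreserving (Φ.flow t) (localGibbsLaw σ (fun _ => a) (fun _ => u) (fun _ => θ) N Φ)
      (localGibbsLaw σ (fun _ => a) (fun _ => u) (fun _ => θ) N Φ))
    (hpair : ∀ i j : Fin (N + 1), i ≠ j → ∀ T : Set T3, MeasurableSet T →
      posGibbsMeasure (fun _ : T3 => (1 : ℝ)) (hsDiameter σ N) (N + 1) {x | x i - x j ∈ T} ≤ 4 * volume T)
    (htriple : ∀ i j k : Fin (N + 1), i ≠ j → i ≠ k → j ≠ k → ∀ T T' : Set T3, MeasurableSet T →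
      MeasurableSet T' →
      posGibbsMeasure (fun _ : T3 => (1 : ℝ)) (hsDiameter σ N) (N + 1) {x | x j - x i ∈ T ∧ x k - x i ∈ T'} ≤
        8 * (volume T * volume T'))
    (htube : ∀ h : ℝ, 0 ≤ h → ∃ S : V3 → Set V3, MeasurableSet {q : V3 × V3 | q.1 ∈ S q.2} ∧
      (∀ u, volume (S u) ≤ ENNReal.ofReal (4 * hsDiameter σ N ^ 2 * h * ‖u‖)) ∧
      ∀ (u r : V3) (s : ℝ), hsDiameter σ N ≤ ‖r‖ → s ∈ Icc 0 h → ‖r + s • u‖ = hsDiameter σ N → r ∈ S u)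
    (hlift : ∀ B : Set V3, MeasurableSet B →
      volume {x : T3 | ∃ k : Fin 3 → ℤ, Torus.reprSym x + Torus.latticeVec k ∈ B} ≤ volume B)
    {τ : ℝ} (hτ : 0 < τ) {ℓ : ℝ} (hℓ : 0 < ℓ) :
    ∫⁻ z, Φ.good.indicator (fun z => ENNReal.ofReal
        (collisionPairSum (Torus.geometry (Fin 3)) (hsDiameter σ N) (orbit σ N Φ z) (Icc 0 τ)
          (fun s i j => if s - ℓ < pairFlightStart σ N Φ z i j s then (1 : ℝ) else 0))) z
        ∂(localGibbsLaw σ (fun _ => a) (fun _ => u) (fun _ => θ) N Φ) ≤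
      ENNReal.ofReal (16 * ℓ * ((N + 1 : ℕ) : ℝ) ^ 2 * hsDiameter σ N ^ 2) *
          ∫⁻ q, ENNReal.ofReal ‖q.2 - q.1‖ ∂((gaussMeasure u θ).prod (gaussMeasure u θ)) +
        ENNReal.ofReal (64 * τ * ℓ * ((N + 1 : ℕ) : ℝ) ^ 2 * hsDiameter σ N ^ 2 +
            512 * τ * ℓ * ((N + 1 : ℕ) : ℝ) ^ 3 * hsDiameter σ N ^ 4) *
          ∫⁻ q, ENNReal.ofReal (‖q.2 - q.1‖ ^ 2) ∂((gaussMeasure u θ).prod (gaussMeasure u θ)) := by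
  classical
  set P := localGibbsLaw σ (fun _ => a) (fun _ => u) (fun _ => θ) N Φ with hPdef
  set m₁ := ∫⁻ q, ENNReal.ofReal ‖q.2 - q.1‖ ∂((gaussMeasure u θ).prod (gaussMeasure u θ)) with hm₁
  set m₂ := ∫⁻ q, ENNReal.ofReal (‖q.2 - q.1‖ ^ 2) ∂((gaussMeasure u θ).prod (gaussMeasure u θ)) with hm₂
  have hε4 : hsDiameter σ N ≤ 1 / 4 := (hsDiameter_le hσ N).trans hσ4
  have hε2 : hsDiameter σ N < 1 / 2 := by linarith
  have hσ2 : σ ≤ 1 / 2 := by linarith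
  set R : ℝ := (1 / 2 - hsDiameter σ N) / ℓ with hRdef
  have hR : 0 < R := div_pos (by linarith) hℓ
  -- the three charged terms, cut to the good set
  set K₁ : Phase N → ℝ := fun z => Φ.collisionSum (Icc 0 ℓ) (fun _ => (1 : ℝ)) z with hK₁
  set K₃ : Phase N → ℝ := fun z => Φ.collisionSum (Icc 0 τ)
    (fun c => (fun m : ℝ × T3 × V3 × V3 × V3 => ‖m.2.2.2.2 - m.2.2.2.1‖ / R) c.mark) z with hK₃
  set F₃ : Phase N → ℝ≥0∞ := fun z => ∑ᶠ s ∈ collisionTimes (Torus.geometry (Fin 3)) (hsDiameter σ N)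
        (fun t => Φ.flow t z) ∩ Icc 0 τ,
      ∑ i : Fin (N + 1), ∑ j : Fin (N + 1),
        (if i ≠ j ∧ ‖(Torus.geometry (Fin 3)).sepVec (Φ.flow s z i).1 (Φ.flow s z j).1‖ = hsDiameter σ N
          then (∑ j' : Fin (N + 1), if j' ≠ i ∧ j' ≠ j ∧ ∃ t ∈ Ioo 0 ℓ,
            ‖Torus.reprSym (((Φ.flow s z j').1 - (Φ.flow s z i).1) +
              Torus.proj (t • ((Φ.flow s z j').2 - (Φ.flow s z i).2)))‖ = hsDiameter σ N
            then (1 : ℝ≥0∞) else 0) else 0) with hF₃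
  set G₁ : Phase N → ℝ≥0∞ := fun z => ENNReal.ofReal (Φ.good.indicator K₁ z) with hG₁
  set G₂ : Phase N → ℝ≥0∞ := fun z => ENNReal.ofReal (Φ.good.indicator K₃ z) with hG₂
  set G₃ : Phase N → ℝ≥0∞ := Φ.good.indicator F₃ with hG₃
  have hG₁m : Measurable G₁ := measurable_ofReal_indicator_countSum Φ hε2 ℓ
  have hG₂m : Measurable G₂ := measurable_ofReal_indicator_relSpeedSum Φ hε2 τ R
  -- pathwise: the charging `#short ≤ K₁ + K₃ + 2 K_F` on the good set
  have hdom : ∀ z, Φ.good.indicator (fun z => ENNReal.ofReal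
      (collisionPairSum (Torus.geometry (Fin 3)) (hsDiameter σ N) (orbit σ N Φ z) (Icc 0 τ)
        (fun s i j => if s - ℓ < pairFlightStart σ N Φ z i j s then (1 : ℝ) else 0))) z ≤
      G₁ z + G₂ z + 2 * G₃ z := by
    intro z
    by_cases hz : z ∈ Φ.good
    · rw [indicator_of_mem hz]
      have hch := shortFlightCount_le_chargedSums hz hε2 τ hℓ
      have hfinτ := (isTraj hz).locFinite 0 τ
      have hfinℓ := (isTraj hz).locFinite 0 ℓ
      set A₀ := collisionPairSum (Torus.geometry (Fin 3)) (hsDiameter σ N) (orbit σ N Φ z) (Icc 0 τ)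
        (fun s i j => if s - ℓ < pairFlightStart σ N Φ z i j s then (1 : ℝ) else 0) with hA₀
      set A₁ := collisionPairSum (Torus.geometry (Fin 3)) (hsDiameter σ N) (orbit σ N Φ z) (Icc 0 ℓ)
        (fun _ _ _ => (1 : ℝ)) with hA₁
      set A₃ := collisionPairSum (Torus.geometry (Fin 3)) (hsDiameter σ N) (orbit σ N Φ z) (Icc 0 τ)
        (fun s i j => ‖(orbit σ N Φ z s j).2 - (orbit σ N Φ z s i).2‖ / ((1 / 2 - hsDiameter σ N) / ℓ)) with hA₃
      set AF := collisionPairSum (Torus.geometry (Fin 3)) (hsDiameter σ N) (orbit σ N Φ z) (Icc 0 τ)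
        (fun s i j => ∑ j' : Fin (N + 1), if j' ≠ i ∧ j' ≠ j ∧ ∃ t ∈ Ioo 0 ℓ,
          ‖Torus.reprSym (((orbit σ N Φ z s j').1 - (orbit σ N Φ z s i).1) +
            Torus.proj (t • ((orbit σ N Φ z s j').2 - (orbit σ N Φ z s i).2)))‖ = hsDiameter σ N
          then (1 : ℝ) else 0) with hAF
      have hA₁0 : 0 ≤ A₁ := collisionPairSum_nonneg fun _ _ _ => zero_le_one
      have hA₃0 : 0 ≤ A₃ := collisionPairSum_nonneg fun _ _ _ => div_nonneg (norm_nonneg _) hR.le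
      have hAF0 : 0 ≤ AF :=
        collisionPairSum_nonneg fun _ _ _ => Finset.sum_nonneg fun j' _ => by split_ifs <;> norm_num
      -- the three identifications
      have h1 : ENNReal.ofReal A₁ = G₁ z := by
        show _ = ENNReal.ofReal (Φ.good.indicator K₁ z)
        rw [indicator_of_mem hz]
        rfl
      have h2 : ENNReal.ofReal A₃ = G₂ z := by
        show _ = ENNReal.ofReal (Φ.good.indicator K₃ z)
        rw [indicator_of_mem hz]
        show _ = ENNReal.ofReal (Φ.collisionSum (Icc 0 τ)
          (fun c => (fun m : ℝ × T3 × V3 × V3 × V3 => ‖m.2.2.2.2 - m.2.2.2.1‖ / R) c.mark) z)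
        rw [collisionSum_relSpeed_eq]
      have h3 : ENNReal.ofReal AF = G₃ z := by
        rw [hG₃, indicator_of_mem hz]
        exact ofReal_collisionPairSum_eq hz hfinτ
          (g' := fun s i j => ∑ j' : Fin (N + 1), if j' ≠ i ∧ j' ≠ j ∧ ∃ t ∈ Ioo 0 ℓ,
            ‖Torus.reprSym (((orbit σ N Φ z s j').1 - (orbit σ N Φ z s i).1) +
              Torus.proj (t • ((orbit σ N Φ z s j').2 - (orbit σ N Φ z s i).2)))‖ = hsDiameter σ N
            then (1 : ℝ≥0∞) else 0)
          (fun s i j => Finset.sum_nonneg fun j' _ => by split_ifs <;> norm_num)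
          (fun s i j => by
            rw [ENNReal.ofReal_sum_of_nonneg fun j' _ => by split_ifs <;> norm_num]
            refine Finset.sum_congr rfl fun j' _ => ?_
            split_ifs <;> simp)
      calc ENNReal.ofReal A₀ ≤ ENNReal.ofReal (A₁ + A₃ + 2 * AF) := ENNReal.ofReal_le_ofReal hch
        _ = ENNReal.ofReal A₁ + ENNReal.ofReal A₃ + 2 * ENNReal.ofReal AF := by
            rw [ENNReal.ofReal_add (add_nonneg hA₁0 hA₃0) (by positivity), ENNReal.ofReal_add hA₁0 hA₃0,
              ENNReal.ofReal_mul zero_le_two, ENNReal.ofReal_ofNat]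
        _ = G₁ z + G₂ z + 2 * G₃ z := by rw [h1, h2, h3]
    · rw [indicator_of_notMem hz]
      exact bot_le
  -- the three means
  have hb₁ : ∫⁻ z, G₁ z ∂P ≤ ENNReal.ofReal (16 * ℓ * ((N + 1 : ℕ) : ℝ) ^ 2 * hsDiameter σ N ^ 2) * m₁ := by
    have h := localGibbsLaw_lintegral_le_of_le_collisionMarkSum hσ2 ha hθ u Φ hstat hpair htube hlift hℓ
      (b := fun _ => (1 : ℝ≥0∞)) measurable_const G₁ (fun z hz => by
        show ENNReal.ofReal (Φ.good.indicator K₁ z) ≤ _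
        rw [indicator_of_mem hz]
        exact le_of_eq (ofReal_collisionPairSum_eq hz ((isTraj hz).locFinite 0 ℓ) (S := Icc 0 ℓ)
          (g := fun _ _ _ => (1 : ℝ)) (g' := fun _ _ _ => (1 : ℝ≥0∞)) (fun _ _ _ => zero_le_one)
          (fun _ _ _ => ENNReal.ofReal_one)))
    refine h.trans (le_of_eq ?_)
    simp only [mul_one]
    rw [show (4 : ℝ≥0∞) = ENNReal.ofReal 4 by norm_num, ← ENNReal.ofReal_mul (by norm_num)]
    congr 1
    congr 1
    ring
  have hb₂ : ∫⁻ z, G₂ z ∂P ≤ ENNReal.ofReal (64 * τ * ℓ * ((N + 1 : ℕ) : ℝ) ^ 2 * hsDiameter σ N ^ 2) * m₂ := by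
    have h := localGibbsLaw_lintegral_le_of_le_collisionMarkSum hσ2 ha hθ u Φ hstat hpair htube hlift hτ
      (b := fun q : V3 × V3 => ENNReal.ofReal (‖q.2 - q.1‖ / R)) (by fun_prop) G₂ (fun z hz => by
        show ENNReal.ofReal (Φ.good.indicator K₃ z) ≤ _
        rw [indicator_of_mem hz]
        show ENNReal.ofReal (Φ.collisionSum (Icc 0 τ)
          (fun c => (fun m : ℝ × T3 × V3 × V3 × V3 => ‖m.2.2.2.2 - m.2.2.2.1‖ / R) c.mark) z) ≤ _
        rw [collisionSum_relSpeed_eq]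
        exact le_of_eq (ofReal_collisionPairSum_eq hz ((isTraj hz).locFinite 0 τ)
          (g' := fun s i j => ENNReal.ofReal (‖(orbit σ N Φ z s j).2 - (orbit σ N Φ z s i).2‖ / R))
          (fun _ _ _ => div_nonneg (norm_nonneg _) hR.le) (fun _ _ _ => rfl)))
    refine h.trans ?_
    have hI : ∫⁻ p, ENNReal.ofReal ‖p.2 - p.1‖ * ENNReal.ofReal (‖p.2 - p.1‖ / R)
        ∂((gaussMeasure u θ).prod (gaussMeasure u θ)) = m₂ * ENNReal.ofReal R⁻¹ := by
      rw [hm₂, ← lintegral_mul_const' _ _ ENNReal.ofReal_ne_top]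
      refine lintegral_congr fun p => ?_
      rw [← ENNReal.ofReal_mul (norm_nonneg _), ← ENNReal.ofReal_mul (by positivity)]
      congr 1
      rw [div_eq_mul_inv, sq, mul_assoc]
    rw [hI, show (4 : ℝ≥0∞) = ENNReal.ofReal 4 by norm_num, ← ENNReal.ofReal_mul (by norm_num), ← mul_assoc,
      mul_comm _ (ENNReal.ofReal R⁻¹), ← mul_assoc, ← ENNReal.ofReal_mul (by positivity)]
    refine mul_le_mul_of_nonneg_right (ENNReal.ofReal_le_ofReal ?_) bot_le
    have hRinv : R⁻¹ ≤ 4 * ℓ := by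
      rw [hRdef, inv_div, div_le_iff₀ (by linarith)]
      nlinarith
    calc R⁻¹ * (4 * (4 * τ * ((N + 1 : ℕ) : ℝ) ^ 2 * hsDiameter σ N ^ 2))
        ≤ (4 * ℓ) * (4 * (4 * τ * ((N + 1 : ℕ) : ℝ) ^ 2 * hsDiameter σ N ^ 2)) :=
          mul_le_mul_of_nonneg_right hRinv (by positivity)
      _ = 64 * τ * ℓ * ((N + 1 : ℕ) : ℝ) ^ 2 * hsDiameter σ N ^ 2 := by ring
  have hb₃ : ∫⁻ z, G₃ z ∂P ≤ ENNReal.ofReal (256 * τ * ℓ * ((N + 1 : ℕ) : ℝ) ^ 3 * hsDiameter σ N ^ 4) * m₂ :=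
    localGibbsLaw_lintegral_le_of_le_fwdHitCollisionSum hσ2 ha hθ u Φ hstat htriple htube hlift hτ hℓ G₃
      (fun z hz => by
        rw [hG₃, indicator_of_mem hz])
  -- assemble
  calc ∫⁻ z, Φ.good.indicator (fun z => ENNReal.ofReal
        (collisionPairSum (Torus.geometry (Fin 3)) (hsDiameter σ N) (orbit σ N Φ z) (Icc 0 τ)
          (fun s i j => if s - ℓ < pairFlightStart σ N Φ z i j s then (1 : ℝ) else 0))) z ∂P
      ≤ ∫⁻ z, (G₁ z + G₂ z + 2 * G₃ z) ∂P := lintegral_mono hdom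
    _ = ∫⁻ z, (G₁ z + G₂ z) ∂P + ∫⁻ z, 2 * G₃ z ∂P := lintegral_add_left (hG₁m.add hG₂m) _
    _ = ∫⁻ z, G₁ z ∂P + ∫⁻ z, G₂ z ∂P + 2 * ∫⁻ z, G₃ z ∂P := by
        rw [lintegral_add_left hG₁m, lintegral_const_mul' _ _ ENNReal.ofNat_ne_top]
    _ ≤ ENNReal.ofReal (16 * ℓ * ((N + 1 : ℕ) : ℝ) ^ 2 * hsDiameter σ N ^ 2) * m₁ +
          ENNReal.ofReal (64 * τ * ℓ * ((N + 1 : ℕ) : ℝ) ^ 2 * hsDiameter σ N ^ 2) * m₂ +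
          2 * (ENNReal.ofReal (256 * τ * ℓ * ((N + 1 : ℕ) : ℝ) ^ 3 * hsDiameter σ N ^ 4) * m₂) :=
        add_le_add (add_le_add hb₁ hb₂) (mul_le_mul_right hb₃ 2)
    _ = ENNReal.ofReal (16 * ℓ * ((N + 1 : ℕ) : ℝ) ^ 2 * hsDiameter σ N ^ 2) * m₁ +
          ENNReal.ofReal (64 * τ * ℓ * ((N + 1 : ℕ) : ℝ) ^ 2 * hsDiameter σ N ^ 2 +
            512 * τ * ℓ * ((N + 1 : ℕ) : ℝ) ^ 3 * hsDiameter σ N ^ 4) * m₂ := by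
        rw [← mul_assoc, show (2 : ℝ≥0∞) = ENNReal.ofReal 2 by norm_num, ← ENNReal.ofReal_mul (by norm_num),
          add_assoc, ← add_mul, ← ENNReal.ofReal_add (by positivity) (by positivity)]
        congr 3
        ring

/-! ## Scaling bookkeeping -/

/-- `(N+1) · t_N³ = 1`. [folklore] -/
theorem succ_mul_tN_pow_three (N : ℕ) : ((N : ℝ) + 1) * tN N ^ 3 = 1 := by
  have hN : (0 : ℝ) < (N : ℝ) + 1 := by positivity
  unfold tN
  rw [← Real.rpow_natCast, ← Real.rpow_mul hN.le]
  norm_num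
  rw [Real.rpow_neg_one, mul_inv_cancel₀ hN.ne']

/-- `t_N ≤ 1` (private copy of the glue's `tN_le_one`, to keep this helper's imports light). [folklore] -/
private theorem tN_le_one_aux (N : ℕ) : tN N ≤ 1 := by
  unfold tN
  exact Real.rpow_le_one_of_one_le_of_nonpos (by simp) (by norm_num)

/-- `ε = σ t_N` (`hsDiameter σ N = σ (N+1)^{-1/3}`; private copy of the glue's `hsDiameter_eq_mul_tN`).
[folklore] -/
private theorem hsDiameter_eq_mul_tN_aux (σ : ℝ) (N : ℕ) : hsDiameter σ N = σ * tN N := by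
  rw [hsDiameter, tN, Nat.cast_succ]

/-! ## The stub at rung 0 -/

/-- **Stub U (`stub_shortFlightLG`) at RUNG 0, mean form.** For CONSTANT profiles `a, θ > 0`, `u` there is
`σ₀ > 0` such that for every reduced diameter `0 < σ < σ₀`, every family of hard-sphere flows, horizon `τ > 0`
and `δ > 0` there are `A > 0` and `N₀` with: for all `N ≥ N₀`, the mean under the (invariant) local Gibbs law
with constant profiles of the normalised number of collisions `(i, n)`, `n < cnt_i(τ)`, whose typed past shows a
flight of `i` shorter than `t_N / A` (`t_{i,n} −` start of the flight of `i` ending at `t_{i,n}`), times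
`ε/(N+1)`, is at most `δ` — the registered stub's conclusion verbatim at constant profiles
(`E ≤ M₁ (16 σ³ t_N + 64 τ σ³ t_N + 512 τ σ⁵)/A`, `M₁ = 1 + 4(‖u‖² + 3θ)`; `A = M₁ (16 + 576 τ)/δ`, `N₀ = 1`).
[folklore] -/
theorem shortFlightLG_rung0 :
    ∀ (a θ : ℝ) (u : V3), 0 < a → 0 < θ →
    ∃ σ₀ : ℝ, 0 < σ₀ ∧ ∀ σ : ℝ, 0 < σ → σ < σ₀ → ∀ Φ : (N : ℕ) → Flow σ N, ∀ τ : ℝ, 0 < τ →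
    ∀ δ : ℝ, 0 < δ → ∃ A : ℝ, 0 < A ∧ ∃ N₀ : ℕ, ∀ N : ℕ, N₀ ≤ N →
    ∫⁻ z, ENNReal.ofReal (hsDiameter σ N / ((N : ℝ) + 1) *
        ∑ i : Fin (N + 1), ∑ n ∈ Finset.range (cnt (Φ N) τ z i),
          (if (past (Φ N) (rs N) z i n).2.2.2 - (past (Φ N) (rs N) z i n).2.1 < tN N / A then (1 : ℝ) else 0))
        ∂(localGibbsLaw σ (fun _ => a) (fun _ => u) (fun _ => θ) N (Φ N)) ≤ ENNReal.ofReal δ := by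
  intro a θ u ha hθ
  obtain ⟨σ₁, hσ₁, hsmall⟩ := exists_smallDensity uniformProfile one_pos
  refine ⟨min σ₁ (1 / 4), lt_min hσ₁ (by norm_num), fun σ hσ hσlt Φ τ hτ δ hδ => ?_⟩
  have hsm : SmallDensity uniformProfile σ := (hsmall σ hσ (hσlt.trans_le (min_le_left _ _))).1
  have hσ4 : σ ≤ 1 / 4 := (hσlt.trans_le (min_le_right _ _)).le
  have hσ1 : σ ≤ 1 := by linarith
  set M₁ : ℝ := 1 + 4 * (‖u‖ ^ 2 + 3 * θ) with hM₁
  have hM₁0 : 0 < M₁ := by positivity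
  set A : ℝ := M₁ * (16 + 576 * τ) / δ with hA
  have hA0 : 0 < A := by positivity
  refine ⟨A, hA0, 1, fun N hN => ?_⟩
  have hε : 0 < hsDiameter σ N := hsDiameter_pos hσ N
  have hε4 : hsDiameter σ N ≤ 1 / 4 := (hsDiameter_le hσ.le N).trans hσ4
  have hε2 : hsDiameter σ N < 1 / 2 := by linarith
  have hn : (0 : ℝ) < (N : ℝ) + 1 := by positivity
  have htN := tN_pos N
  have hℓ : 0 < tN N / A := div_pos htN hA0
  set P := localGibbsLaw σ (fun _ => a) (fun _ => u) (fun _ => θ) N (Φ N) with hP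
  set c : ℝ := hsDiameter σ N / ((N : ℝ) + 1) with hc
  have hc0 : 0 ≤ c := by positivity
  -- the mean of the short-flight count, statics discharged at small density
  have hmean := localGibbsLaw_lintegral_shortFlightCount_le hσ.le hσ4 ha hθ u (Φ N)
    (measurePreserving_flow_localGibbsLaw_const σ a θ u N (Φ N))
    (fun i j hij T hT => posGibbs_pairEvent_le hsm hN hij hT)
    (fun i j k hij hik hjk T T' hT hT' => posGibbs_tripleEvent_le hsm hij hik hjk hT hT')
    (fun h hh => exists_sweptTube (hsDiameter_pos hσ N) hh)
    (fun S hS => by simpa only [sub_zero] using volume_setOf_exists_reprSym_add_latticeVec_mem_le 0 hS) hτ hℓ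
  -- pathwise on the good set: the integrand is `c ×` the short-flight functional (step 1)
  have hdom : ∀ z ∈ (Φ N).good, ENNReal.ofReal (c *
      ∑ i : Fin (N + 1), ∑ n ∈ Finset.range (cnt (Φ N) τ z i),
        (if (past (Φ N) (rs N) z i n).2.2.2 - (past (Φ N) (rs N) z i n).2.1 < tN N / A then (1 : ℝ) else 0)) ≤
      ENNReal.ofReal c * (Φ N).good.indicator (fun z => ENNReal.ofReal
        (collisionPairSum (Torus.geometry (Fin 3)) (hsDiameter σ N) (orbit σ N (Φ N) z) (Icc 0 τ)
          (fun s i j => if s - tN N / A < pairFlightStart σ N (Φ N) z i j s then (1 : ℝ) else 0))) z := by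
    intro z hz
    rw [indicator_of_mem hz, ← ENNReal.ofReal_mul hc0]
    refine ENNReal.ofReal_le_ofReal (mul_le_mul_of_nonneg_left ?_ hc0)
    have h := sum_shortFlag_le_collisionPairSum hz hε2 τ (tN N / A)
    refine Eq.trans_le ?_ h
    refine Finset.sum_congr rfl fun i _ => Finset.sum_congr rfl fun n _ => ?_
    rw [(past_time_eq hz (rs N) i n).1, (past_time_eq hz (rs N) i n).2]
  have hae : ∀ᵐ z ∂P, z ∈ (Φ N).good := by
    have h0 : P (Φ N).goodᶜ = 0 := by
      rw [hP, localGibbsLaw_eq]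
      exact localGibbsMeasure_absolutelyContinuous σ _ _ _ N (Φ N) (Φ N).measure_compl_good
    rw [ae_iff]
    exact h0
  -- Gaussian moments and scaling
  have hm₁ := lintegral_relSpeed_le u hθ
  have hm₂ : ∫⁻ q, ENNReal.ofReal (‖q.2 - q.1‖ ^ 2) ∂((gaussMeasure u θ).prod (gaussMeasure u θ)) ≤
      ENNReal.ofReal M₁ :=
    (lintegral_relSpeed_sq_le u hθ).trans (ENNReal.ofReal_le_ofReal (by linarith))
  have hcast : ((N + 1 : ℕ) : ℝ) = (N : ℝ) + 1 := by push_cast; ring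
  have he : hsDiameter σ N = σ * tN N := hsDiameter_eq_mul_tN_aux σ N
  have hnt : ((N : ℝ) + 1) * tN N ^ 3 = 1 := succ_mul_tN_pow_three N
  have ht1 : tN N ≤ 1 := tN_le_one_aux N
  have hσ3t : σ ^ 3 * tN N ≤ 1 := by
    calc σ ^ 3 * tN N ≤ 1 ^ 3 * 1 := mul_le_mul (pow_le_pow_left₀ hσ.le hσ1 3) ht1 htN.le (by positivity)
      _ = 1 := by norm_num
  have hσ5 : σ ^ 5 ≤ 1 := pow_le_one₀ hσ.le hσ1
  have hAne : A ≠ 0 := hA0.ne'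
  have hM₁ne : M₁ ≠ 0 := hM₁0.ne'
  have h16 : (16 + 576 * τ : ℝ) ≠ 0 := by positivity
  have hkey : c * (16 * (tN N / A) * ((N + 1 : ℕ) : ℝ) ^ 2 * hsDiameter σ N ^ 2 * M₁ +
      (64 * τ * (tN N / A) * ((N + 1 : ℕ) : ℝ) ^ 2 * hsDiameter σ N ^ 2 +
        512 * τ * (tN N / A) * ((N + 1 : ℕ) : ℝ) ^ 3 * hsDiameter σ N ^ 4) * M₁) ≤ δ := by
    rw [hcast, hc, he]
    calc σ * tN N / ((N : ℝ) + 1) * (16 * (tN N / A) * ((N : ℝ) + 1) ^ 2 * (σ * tN N) ^ 2 * M₁ +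
          (64 * τ * (tN N / A) * ((N : ℝ) + 1) ^ 2 * (σ * tN N) ^ 2 +
            512 * τ * (tN N / A) * ((N : ℝ) + 1) ^ 3 * (σ * tN N) ^ 4) * M₁)
        = M₁ / A * (σ ^ 3 * tN N * (16 + 64 * τ) * (((N : ℝ) + 1) * tN N ^ 3) +
            512 * τ * σ ^ 5 * (((N : ℝ) + 1) * tN N ^ 3) ^ 2) := by
          field_simp
          ring
      _ = M₁ / A * (σ ^ 3 * tN N * (16 + 64 * τ) + 512 * τ * σ ^ 5) := by rw [hnt]; ring
      _ ≤ M₁ / A * (1 * (16 + 64 * τ) + 512 * τ * 1) := by gcongr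
      _ = δ := by
          rw [hA]
          field_simp
          ring
  calc ∫⁻ z, ENNReal.ofReal (c *
        ∑ i : Fin (N + 1), ∑ n ∈ Finset.range (cnt (Φ N) τ z i),
          (if (past (Φ N) (rs N) z i n).2.2.2 - (past (Φ N) (rs N) z i n).2.1 < tN N / A then (1 : ℝ) else 0)) ∂P
      ≤ ∫⁻ z, ENNReal.ofReal c * (Φ N).good.indicator (fun z => ENNReal.ofReal
          (collisionPairSum (Torus.geometry (Fin 3)) (hsDiameter σ N) (orbit σ N (Φ N) z) (Icc 0 τ)
            (fun s i j => if s - tN N / A < pairFlightStart σ N (Φ N) z i j s then (1 : ℝ) else 0))) z ∂P :=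
        lintegral_mono_ae (by filter_upwards [hae] with z hz using hdom z hz)
    _ = ENNReal.ofReal c * ∫⁻ z, (Φ N).good.indicator (fun z => ENNReal.ofReal
          (collisionPairSum (Torus.geometry (Fin 3)) (hsDiameter σ N) (orbit σ N (Φ N) z) (Icc 0 τ)
            (fun s i j => if s - tN N / A < pairFlightStart σ N (Φ N) z i j s then (1 : ℝ) else 0))) z ∂P :=
        lintegral_const_mul' _ _ ENNReal.ofReal_ne_top
    _ ≤ ENNReal.ofReal c * (ENNReal.ofReal (16 * (tN N / A) * ((N + 1 : ℕ) : ℝ) ^ 2 * hsDiameter σ N ^ 2) *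
            ∫⁻ q, ENNReal.ofReal ‖q.2 - q.1‖ ∂((gaussMeasure u θ).prod (gaussMeasure u θ)) +
          ENNReal.ofReal (64 * τ * (tN N / A) * ((N + 1 : ℕ) : ℝ) ^ 2 * hsDiameter σ N ^ 2 +
              512 * τ * (tN N / A) * ((N + 1 : ℕ) : ℝ) ^ 3 * hsDiameter σ N ^ 4) *
            ∫⁻ q, ENNReal.ofReal (‖q.2 - q.1‖ ^ 2) ∂((gaussMeasure u θ).prod (gaussMeasure u θ))) :=
        mul_le_mul_right hmean _
    _ ≤ ENNReal.ofReal c * (ENNReal.ofReal (16 * (tN N / A) * ((N + 1 : ℕ) : ℝ) ^ 2 * hsDiameter σ N ^ 2) *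
            ENNReal.ofReal M₁ +
          ENNReal.ofReal (64 * τ * (tN N / A) * ((N + 1 : ℕ) : ℝ) ^ 2 * hsDiameter σ N ^ 2 +
              512 * τ * (tN N / A) * ((N + 1 : ℕ) : ℝ) ^ 3 * hsDiameter σ N ^ 4) * ENNReal.ofReal M₁) := by
        gcongr
    _ = ENNReal.ofReal (c * (16 * (tN N / A) * ((N + 1 : ℕ) : ℝ) ^ 2 * hsDiameter σ N ^ 2 * M₁ +
          (64 * τ * (tN N / A) * ((N + 1 : ℕ) : ℝ) ^ 2 * hsDiameter σ N ^ 2 +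
            512 * τ * (tN N / A) * ((N + 1 : ℕ) : ℝ) ^ 3 * hsDiameter σ N ^ 4) * M₁)) := by
        rw [← ENNReal.ofReal_mul (by positivity), ← ENNReal.ofReal_mul (by positivity),
          ← ENNReal.ofReal_add (by positivity) (by positivity), ← ENNReal.ofReal_mul hc0]
    _ ≤ ENNReal.ofReal δ := ENNReal.ofReal_le_ofReal hkey

end Summit.AtomisticToContinuum.HydrodynamicLimit.Theorems.KickFairRelEquilibriumMesoLine

end
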